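import Summits.Ventures.AbcSig.Rows.TemplateC2a
import Summits.Ventures.AbcSig.Rows.XTemplateB

/-!
# Venture AbcSig — EXTENDED-EXCLUSION twin of `Rows/TemplateC2a.lean` (GENERATED by gen/mkxtemplates.py)

HONEST FRAMING. Template file of a COMPUTATION cell (`pub-abcsig`); no claim on ABC or any summit. Each theorem
`x<name>` below is the theorem `<name>` of `Rows/TemplateC2a.lean` with ONE change: the per-orbit alternative of every level
hypothesis reads `o.Eliminated bs04Allowed n ∨ (M.Excludes N o fam ∨ M.ExcludesStd N o n)` instead of
`o.Eliminated bs04Allowed n ∨ M.Excludes N o fam`, where `M.ExcludesStd N o n` (`Recipes/EisPackage.lean`) says that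
no STANDING datum with exponent `n` has its mod-`n` representation arising from a newform matching `o` — the shape
in which the cell's module-M6 (Eisenstein congruence) certificates are discharged by the kernel
(`NewformModel.excludesStd_of_m6`, given the cited `EisPackage` and the computed `Refines`). Proofs are the originals
verbatim up to the renamed callee; the final step is `xno_solution_in_case`.
-/

namespace Summit.Ventures.AbcSig



/-- **Class `a ≥ 7`** (level `2ℓ` only). -/
theorem xrowC2a_age7 (ℓ : ℕ) (hℓ : ℓ.Prime) (hℓ2 : ℓ ≠ 2) (M : NewformModel) (hP : M.BS04Package)
    (n : ℕ) (hn : n.Prime) (h7 : 7 ≤ n) (hnℓ : n ≠ ℓ) {orbs2 : List OrbitData} (hD2 : M.DataComplete (2 * ℓ) orbs2) (a m : ℕ) (ha : 7 ≤ a)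
    (hm : 1 ≤ m) (han : a < n) (hmn : m < n)
    (hS2 : ∀ o ∈ orbs2, (∀ e ∈ o.coeffs, e.ell.Prime ∧ e.ell ≠ 2 ∧ ¬ e.ell ∣ 2 * ℓ) ∧
      (o.Eliminated bs04Allowed n ∨ (M.Excludes (2 * ℓ) o (famB (2 ^ a * ℓ ^ m) n (fun _ _ => True)) ∨ M.ExcludesStd (2 * ℓ) o n)))
    (x y z : ℤ) (hxy1 : x * y ≠ 1) (hxy2 : x * y ≠ -1) : ¬ IsPrimitiveSolution 1 (2 ^ a * ℓ ^ m) 1 n x y z := by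
  have hB : 0 < 2 ^ a * ℓ ^ m := by have := hℓ.pos; positivity
  have hnB := not_dvd_twoPow_primePow ℓ a m n hℓ hn (by omega) hnℓ
  have hfreeB := nthPowerFree_twoPow_primePow ℓ a m n hℓ hℓ2 han hmn
  have hL := (levelsC2a ℓ hℓ hℓ2 n hnℓ a m hm).1
  have hv : (2 : ℤ) ^ 7 ∣ ((2 ^ a * ℓ ^ m : ℕ) : ℤ) * y ^ n := by
    have : (2 : ℕ) ^ 7 ∣ 2 ^ a * ℓ ^ m := Dvd.dvd.mul_right (pow_dvd_pow 2 ha) _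
    have h' : (2 : ℤ) ^ 7 ∣ ((2 ^ a * ℓ ^ m : ℕ) : ℤ) := by exact_mod_cast this
    exact h'.mul_right _
  exact xbranch_v7 _ hB M hP n hn h7 hnB hfreeB (2 * ℓ) hL (fun _ _ => True) hD2 hS2 x y z trivial hv hxy1 hxy2

/-- **Class `a = 6`** (levels `ℓ` for `xy` odd, `2ℓ` for `y` even). -/
theorem xrowC2a_a6 (ℓ : ℕ) (hℓ : ℓ.Prime) (hℓ2 : ℓ ≠ 2) (M : NewformModel) (hP : M.BS04Package)
    (n : ℕ) (hn : n.Prime) (h7 : 7 ≤ n) (hnℓ : n ≠ ℓ) {orbs1 orbs2 : List OrbitData} (hD1 : M.DataComplete ℓ orbs1)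
    (hD2 : M.DataComplete (2 * ℓ) orbs2) (m : ℕ) (hm : 1 ≤ m) (hmn : m < n)
    (hS1 : ∀ o ∈ orbs1, (∀ e ∈ o.coeffs, e.ell.Prime ∧ e.ell ≠ 2 ∧ ¬ e.ell ∣ ℓ) ∧
      (o.Eliminated bs04Allowed n ∨ (M.Excludes ℓ o (famB (2 ^ 6 * ℓ ^ m) n (fun _ _ => True)) ∨ M.ExcludesStd ℓ o n)))
    (hS2 : ∀ o ∈ orbs2, (∀ e ∈ o.coeffs, e.ell.Prime ∧ e.ell ≠ 2 ∧ ¬ e.ell ∣ 2 * ℓ) ∧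
      (o.Eliminated bs04Allowed n ∨ (M.Excludes (2 * ℓ) o (famB (2 ^ 6 * ℓ ^ m) n (fun _ _ => True)) ∨ M.ExcludesStd (2 * ℓ) o n)))
    (x y z : ℤ) (hxy1 : x * y ≠ 1) (hxy2 : x * y ≠ -1) : ¬ IsPrimitiveSolution 1 (2 ^ 6 * ℓ ^ m) 1 n x y z := by
  intro hsol
  have hB : 0 < 2 ^ 6 * ℓ ^ m := by have := hℓ.pos; positivity
  have hnB := not_dvd_twoPow_primePow ℓ 6 m n hℓ hn (by omega) hnℓ
  have hfreeB := nthPowerFree_twoPow_primePow ℓ 6 m n hℓ hℓ2 (by omega) hmn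
  obtain ⟨hL2, hL1, -⟩ := levelsC2a ℓ hℓ hℓ2 n hnℓ 6 m hm
  have hℓodd := prime_odd_int ℓ hℓ hℓ2
  by_cases hy : 2 ∣ y
  · have hv : (2 : ℤ) ^ 7 ∣ ((2 ^ 6 * ℓ ^ m : ℕ) : ℤ) * y ^ n :=
      Dvd.dvd.mul_left ((pow_dvd_pow 2 h7).trans (pow_dvd_pow_of_dvd hy n)) _
    exact xbranch_v7 _ hB M hP n hn h7 hnB hfreeB (2 * ℓ) hL2 (fun _ _ => True) hD2 hS2 x y z trivial hv hxy1 hxy2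
      hsol
  · have hv : OrdTwoEq (((2 ^ 6 * ℓ ^ m : ℕ) : ℤ) * y ^ n) 6 := by
      have : ((2 ^ 6 * ℓ ^ m : ℕ) : ℤ) * y ^ n = 2 ^ 6 * ((ℓ : ℤ) ^ m * y ^ n) := by push_cast; ring
      rw [this]
      exact ordTwoEq_twoPow_mul_odd 6 _ (not_two_dvd_mul (not_two_dvd_pow hℓodd m) (not_two_dvd_pow hy n))
    exact xbranch_v6 _ hB M hP n hn h7 hnB hfreeB ℓ hL1 (fun _ _ => True) hD1 hS1 x y z trivial hv hxy1 hxy2 hsol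

/-- Shared shape of the classes `a ∈ {1, 2, 3, 4, 5}`: `x` is odd; `y` even goes to level `2ℓ` by (v₇). This lemma
isolates the `y`-even half. -/
theorem xrowC2a_yeven (ℓ : ℕ) (hℓ : ℓ.Prime) (hℓ2 : ℓ ≠ 2) (M : NewformModel) (hP : M.BS04Package)
    (n : ℕ) (hn : n.Prime) (h7 : 7 ≤ n) (hnℓ : n ≠ ℓ) {orbs2 : List OrbitData} (hD2 : M.DataComplete (2 * ℓ) orbs2) (a m : ℕ) (hm : 1 ≤ m)
    (han : a < n) (hmn : m < n)
    (hS2 : ∀ o ∈ orbs2, (∀ e ∈ o.coeffs, e.ell.Prime ∧ e.ell ≠ 2 ∧ ¬ e.ell ∣ 2 * ℓ) ∧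
      (o.Eliminated bs04Allowed n ∨ (M.Excludes (2 * ℓ) o (famB (2 ^ a * ℓ ^ m) n (fun _ _ => True)) ∨ M.ExcludesStd (2 * ℓ) o n)))
    (x y z : ℤ) (hy : 2 ∣ y) (hxy1 : x * y ≠ 1) (hxy2 : x * y ≠ -1) :
    ¬ IsPrimitiveSolution 1 (2 ^ a * ℓ ^ m) 1 n x y z := by
  have hB : 0 < 2 ^ a * ℓ ^ m := by have := hℓ.pos; positivity
  have hnB := not_dvd_twoPow_primePow ℓ a m n hℓ hn (by omega) hnℓ
  have hfreeB := nthPowerFree_twoPow_primePow ℓ a m n hℓ hℓ2 han hmn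
  have hL := (levelsC2a ℓ hℓ hℓ2 n hnℓ a m hm).1
  have hv : (2 : ℤ) ^ 7 ∣ ((2 ^ a * ℓ ^ m : ℕ) : ℤ) * y ^ n :=
    Dvd.dvd.mul_left ((pow_dvd_pow 2 h7).trans (pow_dvd_pow_of_dvd hy n)) _
  exact xbranch_v7 _ hB M hP n hn h7 hnB hfreeB (2 * ℓ) hL (fun _ _ => True) hD2 hS2 x y z trivial hv hxy1 hxy2

/-- **Class `a ∈ {4, 5}`** (levels `8ℓ` for `xy` odd, `2ℓ` for `y` even). -/
theorem xrowC2a_a45 (ℓ : ℕ) (hℓ : ℓ.Prime) (hℓ2 : ℓ ≠ 2) (M : NewformModel) (hP : M.BS04Package)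
    (n : ℕ) (hn : n.Prime) (h7 : 7 ≤ n) (hnℓ : n ≠ ℓ) {orbs8 orbs2 : List OrbitData} (hD8 : M.DataComplete (8 * ℓ) orbs8)
    (hD2 : M.DataComplete (2 * ℓ) orbs2) (a m : ℕ) (ha : a = 4 ∨ a = 5) (hm : 1 ≤ m) (han : a < n)
    (hmn : m < n)
    (hS8 : ∀ o ∈ orbs8, (∀ e ∈ o.coeffs, e.ell.Prime ∧ e.ell ≠ 2 ∧ ¬ e.ell ∣ 8 * ℓ) ∧
      (o.Eliminated bs04Allowed n ∨ (M.Excludes (8 * ℓ) o (famB (2 ^ a * ℓ ^ m) n (fun _ _ => True)) ∨ M.ExcludesStd (8 * ℓ) o n)))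
    (hS2 : ∀ o ∈ orbs2, (∀ e ∈ o.coeffs, e.ell.Prime ∧ e.ell ≠ 2 ∧ ¬ e.ell ∣ 2 * ℓ) ∧
      (o.Eliminated bs04Allowed n ∨ (M.Excludes (2 * ℓ) o (famB (2 ^ a * ℓ ^ m) n (fun _ _ => True)) ∨ M.ExcludesStd (2 * ℓ) o n)))
    (x y z : ℤ) (hxy1 : x * y ≠ 1) (hxy2 : x * y ≠ -1) : ¬ IsPrimitiveSolution 1 (2 ^ a * ℓ ^ m) 1 n x y z := by
  intro hsol
  by_cases hy : 2 ∣ y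
  · exact xrowC2a_yeven ℓ hℓ hℓ2 M hP n hn h7 hnℓ hD2 a m hm han hmn hS2 x y z hy hxy1 hxy2 hsol
  have hB : 0 < 2 ^ a * ℓ ^ m := by have := hℓ.pos; positivity
  have hnB := not_dvd_twoPow_primePow ℓ a m n hℓ hn (by omega) hnℓ
  have hfreeB := nthPowerFree_twoPow_primePow ℓ a m n hℓ hℓ2 han hmn
  obtain ⟨-, -, hL8, -⟩ := levelsC2a ℓ hℓ hℓ2 n hnℓ a m hm
  have hℓodd := prime_odd_int ℓ hℓ hℓ2
  have hBeven : 2 ∣ ((2 ^ a * ℓ ^ m : ℕ) : ℤ) := by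
    have : (2 : ℕ) ∣ 2 ^ a * ℓ ^ m := Dvd.dvd.mul_right (dvd_pow_self 2 (by omega)) _
    exact_mod_cast this
  have hx := odd_x_of_even_B hsol hBeven
  have hxy : ¬ 2 ∣ x * y := not_two_dvd_mul hx hy
  have hB45 : OrdTwoEq ((2 ^ a * ℓ ^ m : ℕ) : ℤ) 4 ∨ OrdTwoEq ((2 ^ a * ℓ ^ m : ℕ) : ℤ) 5 := by
    rcases ha with rfl | rfl
    · left; push_cast; exact ordTwoEq_twoPow_mul_odd 4 _ (not_two_dvd_pow hℓodd m)
    · right; push_cast; exact ordTwoEq_twoPow_mul_odd 5 _ (not_two_dvd_pow hℓodd m)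
  exact xbranch_iv45 _ hB M hP n hn h7 hnB hfreeB (8 * ℓ) hL8 (fun _ _ => True) hD8 hS8 x y z trivial hB45 hxy hxy1
    hxy2 hsol

/-- **Class `a = 3`** (levels `32ℓ` for `xy` odd, `2ℓ` for `y` even). -/
theorem xrowC2a_a3 (ℓ : ℕ) (hℓ : ℓ.Prime) (hℓ2 : ℓ ≠ 2) (M : NewformModel) (hP : M.BS04Package)
    (n : ℕ) (hn : n.Prime) (h7 : 7 ≤ n) (hnℓ : n ≠ ℓ) {orbs32 orbs2 : List OrbitData} (hD32 : M.DataComplete (32 * ℓ) orbs32)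
    (hD2 : M.DataComplete (2 * ℓ) orbs2) (m : ℕ) (hm : 1 ≤ m) (hmn : m < n)
    (hS32 : ∀ o ∈ orbs32, (∀ e ∈ o.coeffs, e.ell.Prime ∧ e.ell ≠ 2 ∧ ¬ e.ell ∣ 32 * ℓ) ∧
      (o.Eliminated bs04Allowed n ∨ (M.Excludes (32 * ℓ) o (famB (2 ^ 3 * ℓ ^ m) n (fun _ _ => True)) ∨ M.ExcludesStd (32 * ℓ) o n)))
    (hS2 : ∀ o ∈ orbs2, (∀ e ∈ o.coeffs, e.ell.Prime ∧ e.ell ≠ 2 ∧ ¬ e.ell ∣ 2 * ℓ) ∧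
      (o.Eliminated bs04Allowed n ∨ (M.Excludes (2 * ℓ) o (famB (2 ^ 3 * ℓ ^ m) n (fun _ _ => True)) ∨ M.ExcludesStd (2 * ℓ) o n)))
    (x y z : ℤ) (hxy1 : x * y ≠ 1) (hxy2 : x * y ≠ -1) : ¬ IsPrimitiveSolution 1 (2 ^ 3 * ℓ ^ m) 1 n x y z := by
  intro hsol
  by_cases hy : 2 ∣ y
  · exact xrowC2a_yeven ℓ hℓ hℓ2 M hP n hn h7 hnℓ hD2 3 m hm (by omega) hmn hS2 x y z hy hxy1 hxy2 hsol
  have hB : 0 < 2 ^ 3 * ℓ ^ m := by have := hℓ.pos; positivity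
  have hnB := not_dvd_twoPow_primePow ℓ 3 m n hℓ hn (by omega) hnℓ
  have hfreeB := nthPowerFree_twoPow_primePow ℓ 3 m n hℓ hℓ2 (by omega) hmn
  obtain ⟨-, -, -, hL32, -⟩ := levelsC2a ℓ hℓ hℓ2 n hnℓ 3 m hm
  have hℓodd := prime_odd_int ℓ hℓ hℓ2
  have hBeven : 2 ∣ ((2 ^ 3 * ℓ ^ m : ℕ) : ℤ) := by push_cast; exact Dvd.dvd.mul_right ⟨4, by norm_num⟩ _
  have hx := odd_x_of_even_B hsol hBeven
  have hxy : ¬ 2 ∣ x * y := not_two_dvd_mul hx hy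
  have hB3 : OrdTwoEq ((2 ^ 3 * ℓ ^ m : ℕ) : ℤ) 3 := by
    push_cast; exact ordTwoEq_twoPow_mul_odd 3 _ (not_two_dvd_pow hℓodd m)
  exact xbranch_iv3 _ hB M hP n hn h7 hnB hfreeB (32 * ℓ) hL32 (fun _ _ => True) hD32 hS32 x y z trivial hB3 hxy
    hxy1 hxy2 hsol

/-- **Class `a = 2`** (levels `4ℓ` and `8ℓ` for `xy` odd, `2ℓ` for `y` even). -/
theorem xrowC2a_a2 (ℓ : ℕ) (hℓ : ℓ.Prime) (hℓ2 : ℓ ≠ 2) (M : NewformModel) (hP : M.BS04Package)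
    (n : ℕ) (hn : n.Prime) (h7 : 7 ≤ n) (hnℓ : n ≠ ℓ) {orbs4 orbs8 orbs2 : List OrbitData} (hD4 : M.DataComplete (4 * ℓ) orbs4)
    (hD8 : M.DataComplete (8 * ℓ) orbs8) (hD2 : M.DataComplete (2 * ℓ) orbs2) (m : ℕ) (hm : 1 ≤ m)
    (hmn : m < n)
    (hS4 : ∀ o ∈ orbs4, (∀ e ∈ o.coeffs, e.ell.Prime ∧ e.ell ≠ 2 ∧ ¬ e.ell ∣ 4 * ℓ) ∧
      (o.Eliminated bs04Allowed n ∨ (M.Excludes (4 * ℓ) o (famB (2 ^ 2 * ℓ ^ m) n (fun _ _ => True)) ∨ M.ExcludesStd (4 * ℓ) o n)))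
    (hS8 : ∀ o ∈ orbs8, (∀ e ∈ o.coeffs, e.ell.Prime ∧ e.ell ≠ 2 ∧ ¬ e.ell ∣ 8 * ℓ) ∧
      (o.Eliminated bs04Allowed n ∨ (M.Excludes (8 * ℓ) o (famB (2 ^ 2 * ℓ ^ m) n (fun _ _ => True)) ∨ M.ExcludesStd (8 * ℓ) o n)))
    (hS2 : ∀ o ∈ orbs2, (∀ e ∈ o.coeffs, e.ell.Prime ∧ e.ell ≠ 2 ∧ ¬ e.ell ∣ 2 * ℓ) ∧
      (o.Eliminated bs04Allowed n ∨ (M.Excludes (2 * ℓ) o (famB (2 ^ 2 * ℓ ^ m) n (fun _ _ => True)) ∨ M.ExcludesStd (2 * ℓ) o n)))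
    (x y z : ℤ) (hxy1 : x * y ≠ 1) (hxy2 : x * y ≠ -1) : ¬ IsPrimitiveSolution 1 (2 ^ 2 * ℓ ^ m) 1 n x y z := by
  intro hsol
  by_cases hy : 2 ∣ y
  · exact xrowC2a_yeven ℓ hℓ hℓ2 M hP n hn h7 hnℓ hD2 2 m hm (by omega) hmn hS2 x y z hy hxy1 hxy2 hsol
  have hB : 0 < 2 ^ 2 * ℓ ^ m := by have := hℓ.pos; positivity
  have hnB := not_dvd_twoPow_primePow ℓ 2 m n hℓ hn (by omega) hnℓ
  have hfreeB := nthPowerFree_twoPow_primePow ℓ 2 m n hℓ hℓ2 (by omega) hmn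
  obtain ⟨-, -, -, -, hL4, hL8, -⟩ := levelsC2a ℓ hℓ hℓ2 n hnℓ 2 m hm
  have hℓodd := prime_odd_int ℓ hℓ hℓ2
  have hBeven : 2 ∣ ((2 ^ 2 * ℓ ^ m : ℕ) : ℤ) := by push_cast; exact Dvd.dvd.mul_right ⟨2, by norm_num⟩ _
  have hx := odd_x_of_even_B hsol hBeven
  have hxy : ¬ 2 ∣ x * y := not_two_dvd_mul hx hy
  have hB2 : OrdTwoEq ((2 ^ 2 * ℓ ^ m : ℕ) : ℤ) 2 := by
    push_cast; exact ordTwoEq_twoPow_mul_odd 2 _ (not_two_dvd_pow hℓodd m)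
  exact xbranch_iii _ hB M hP n hn h7 hnB hfreeB (4 * ℓ) (8 * ℓ) hL4 hL8 (fun _ _ => True) hD4 hD8 hS4 hS8 x y z
    trivial hB2 hxy hxy1 hxy2 hsol

/-- **Class `a = 1`** (levels `128ℓ` for `xy` odd, `2ℓ` for `y` even). -/
theorem xrowC2a_a1 (ℓ : ℕ) (hℓ : ℓ.Prime) (hℓ2 : ℓ ≠ 2) (M : NewformModel) (hP : M.BS04Package)
    (n : ℕ) (hn : n.Prime) (h7 : 7 ≤ n) (hnℓ : n ≠ ℓ) {orbs128 orbs2 : List OrbitData} (hD128 : M.DataComplete (128 * ℓ) orbs128)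
    (hD2 : M.DataComplete (2 * ℓ) orbs2) (m : ℕ) (hm : 1 ≤ m) (hmn : m < n)
    (hS128 : ∀ o ∈ orbs128, (∀ e ∈ o.coeffs, e.ell.Prime ∧ e.ell ≠ 2 ∧ ¬ e.ell ∣ 128 * ℓ) ∧
      (o.Eliminated bs04Allowed n ∨ (M.Excludes (128 * ℓ) o (famB (2 ^ 1 * ℓ ^ m) n (fun _ _ => True)) ∨ M.ExcludesStd (128 * ℓ) o n)))
    (hS2 : ∀ o ∈ orbs2, (∀ e ∈ o.coeffs, e.ell.Prime ∧ e.ell ≠ 2 ∧ ¬ e.ell ∣ 2 * ℓ) ∧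
      (o.Eliminated bs04Allowed n ∨ (M.Excludes (2 * ℓ) o (famB (2 ^ 1 * ℓ ^ m) n (fun _ _ => True)) ∨ M.ExcludesStd (2 * ℓ) o n)))
    (x y z : ℤ) (hxy1 : x * y ≠ 1) (hxy2 : x * y ≠ -1) : ¬ IsPrimitiveSolution 1 (2 ^ 1 * ℓ ^ m) 1 n x y z := by
  intro hsol
  by_cases hy : 2 ∣ y
  · exact xrowC2a_yeven ℓ hℓ hℓ2 M hP n hn h7 hnℓ hD2 1 m hm (by omega) hmn hS2 x y z hy hxy1 hxy2 hsol
  have hB : 0 < 2 ^ 1 * ℓ ^ m := by have := hℓ.pos; positivity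
  have hnB := not_dvd_twoPow_primePow ℓ 1 m n hℓ hn (by omega) hnℓ
  have hfreeB := nthPowerFree_twoPow_primePow ℓ 1 m n hℓ hℓ2 (by omega) hmn
  obtain ⟨-, -, -, -, -, -, hL128, -⟩ := levelsC2a ℓ hℓ hℓ2 n hnℓ 1 m hm
  have hℓodd := prime_odd_int ℓ hℓ hℓ2
  have hBeven : 2 ∣ ((2 ^ 1 * ℓ ^ m : ℕ) : ℤ) := by push_cast; exact Dvd.dvd.mul_right ⟨1, by norm_num⟩ _
  have hx := odd_x_of_even_B hsol hBeven
  have hxy : ¬ 2 ∣ x * y := not_two_dvd_mul hx hy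
  have hB1 : OrdTwoEq ((2 ^ 1 * ℓ ^ m : ℕ) : ℤ) 1 := by
    push_cast; exact ordTwoEq_twoPow_mul_odd 1 _ (not_two_dvd_pow hℓodd m)
  exact xbranch_iiB _ hB M hP n hn h7 hnB hfreeB (128 * ℓ) hL128 (fun _ _ => True) hD128 hS128 x y z trivial hB1
    hxy hxy1 hxy2 hsol

/-- **Class `a = 0`** (`B = ℓ^m` odd; levels `32ℓ` for `xy` odd, `2ℓ` for `xy` even). -/
theorem xrowC2a_a0 (ℓ : ℕ) (hℓ : ℓ.Prime) (hℓ2 : ℓ ≠ 2) (M : NewformModel) (hP : M.BS04Package)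
    (n : ℕ) (hn : n.Prime) (h7 : 7 ≤ n) (hnℓ : n ≠ ℓ) {orbs32 orbs2 : List OrbitData} (hD32 : M.DataComplete (32 * ℓ) orbs32)
    (hD2 : M.DataComplete (2 * ℓ) orbs2) (m : ℕ) (hm : 1 ≤ m) (hmn : m < n)
    (hS32 : ∀ o ∈ orbs32, (∀ e ∈ o.coeffs, e.ell.Prime ∧ e.ell ≠ 2 ∧ ¬ e.ell ∣ 32 * ℓ) ∧
      (o.Eliminated bs04Allowed n ∨ (M.Excludes (32 * ℓ) o (famB (2 ^ 0 * ℓ ^ m) n (fun _ _ => True)) ∨ M.ExcludesStd (32 * ℓ) o n)))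
    (hS2 : ∀ o ∈ orbs2, (∀ e ∈ o.coeffs, e.ell.Prime ∧ e.ell ≠ 2 ∧ ¬ e.ell ∣ 2 * ℓ) ∧
      (o.Eliminated bs04Allowed n ∨ (M.Excludes (2 * ℓ) o (famB (2 ^ 0 * ℓ ^ m) n (fun _ _ => True)) ∨ M.ExcludesStd (2 * ℓ) o n)))
    (x y z : ℤ) (hxy1 : x * y ≠ 1) (hxy2 : x * y ≠ -1) : ¬ IsPrimitiveSolution 1 (2 ^ 0 * ℓ ^ m) 1 n x y z := by
  intro hsol
  have hB : 0 < 2 ^ 0 * ℓ ^ m := by have := hℓ.pos; positivity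
  have hnB := not_dvd_twoPow_primePow ℓ 0 m n hℓ hn (by omega) hnℓ
  have hfreeB := nthPowerFree_twoPow_primePow ℓ 0 m n hℓ hℓ2 (by omega) hmn
  obtain ⟨hL2, -, -, -, -, -, -, hL32, hL32', hL2'⟩ := levelsC2a ℓ hℓ hℓ2 n hnℓ 0 m hm
  have hℓodd := prime_odd_int ℓ hℓ hℓ2
  have hBodd : ¬ 2 ∣ ((2 ^ 0 * ℓ ^ m : ℕ) : ℤ) := by
    push_cast; simpa using not_two_dvd_pow hℓodd m
  by_cases hxy : 2 ∣ x * y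
  · exact xbranch_even_Bodd _ hB M hP n hn h7 hnB hfreeB (2 * ℓ) hL2 hL2' (fun _ _ => True) hD2 hS2 x y z
      trivial hxy hsol
  · exact xbranch_i_odd _ hB hBodd M hP n hn h7 hnB hfreeB (32 * ℓ) hL32 hL32' (fun _ _ => True) hD32 hS32
      x y z trivial hxy hxy1 hxy2 hsol

end Summit.Ventures.AbcSig
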